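import Literature.AlgebraicGeometry.Hyperkaehler.KummerTypeK3HilbertSubvariety
import Literature.AlgebraicGeometry.Hyperkaehler.KummerTypeKugaSatakeCorrespondence
import Literature.AlgebraicGeometry.HodgeTheory.MotivatedClassesAlgebraic
import HarnessLib

/-!
# Transfer of the Kuga–Satake statement along algebraic Hodge similitudes of transcendental lattices (Floccari, Geom. Topol. 2026, Remark 3.7; Compos. Math. 2024, §5.1 Lemma; Varesco, Math. Z. 2023, Prop. 3.1) — NAMED FACT

Layer `Literature/AlgebraicGeometry/Hyperkaehler`.  CITE record for the cross-ladder literature-typing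
layer (D-0088(4), tranche LT-H4, seat `hodge-lit-oqh-2`): THE MECHANISM of the "transfer lens" the
ladder HodgeAV asks for (rungs H2/H3), as printed and refereed — if the rational transcendental lattice
of a hyperkähler variety `X` is carried onto that of another, `Y`, by a Hodge similitude INDUCED BY AN
ALGEBRAIC CYCLE on `X × Y`, then the Kuga–Satake statement for `Y` (the property
`Hyperkaehler.IsKSCorrespondenceAlgebraicHK`, file `KugaSatakeCorrespondenceHyperkaehler`) implies the
Kuga–Satake statement for `X`.  Together with the tree's records BY NAME — the `Kumⁿ` theorem
`Voisin2022_kugaSatakeCorrespondence_algebraic_kummerType`, the algebraic transcendental similitudes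
`Floccari2026_associatedK3Surface_kummerType` (`S_K → K`), `Floccari2026_k3HilbertTypeSubvariety_kummerType`
(`i^* : K → W_K`), `FloccariVaresco2024_exists_kum3_hodgeSimilitude` / `Varesco2023_hodgeSimilitude_algebraic_kummerType`
(`Kumⁿ ↔ Kum³`) — this is how Kuga–Satake statements move between deformation types in print.

## Sources (read at source; locators = files of the materialised arXiv texts)

* [Flo26] S. Floccari, *K3 surfaces associated with varieties of generalized Kummer type*, Geom. Topol.
  30 (2026) 1129–1154 (arXiv:2501.02315) [`Floccari2026`; REFEREED], §3.5 [corpus:paper-arxiv-2501.02315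
  p0009:L1–L12]: "Let `X` and `Y` be hyper-Kähler varieties, not necessarily deformation equivalent and
  possibly of different dimensions. Assume that `φ : H²_tr(X,ℚ) → H²_tr(Y,ℚ)` is a rational Hodge
  similitude, i.e., `φ` is an isomorphism of `ℚ`-Hodge structures which multiplies the Beauville-Bogomolov
  form on the left-hand side by some non-zero `k ∈ ℚ`. […] It is then proven in [Varesco 2023] that there
  exists an isogeny `Ψ : KS'(X) → KS'(Y)` of abelian varieties such that [the square with the Kuga–Satake
  correspondences `μ'_X`, `μ'_Y` and `Ψ_*`] commutes"; **Remark 3.7** [p0009:L13–L14], verbatim: "With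
  notation as above, assume that `φ : H²_tr(X,ℚ) → H²_tr(Y,ℚ)` is induced by an algebraic cycle on `X × Y`.
  Then Conjecture 3.3 for `Y` implies Conjecture 3.3 for `X`. Indeed, the above diagram yields
  `μ'_X = (Ψ_*)⁻¹ ∘ μ'_Y ∘ φ`; note that `(Ψ_*)⁻¹ : H¹(KS'(Y),ℚ)^{⊗2} → H¹(KS'(X),ℚ)^{⊗2}` is induced by an
  algebraic cycle, so that the Kuga-Satake correspondence `μ'_X` is algebraic if `μ'_Y` is so." (3.3 in
  the `H²_tr`-form of Remark 3.4 = the tree's predicate.)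
* [Flo24] S. Floccari, Compos. Math. 160 (2024) 388–410 (arXiv:2210.02948) [`Floccari2024`; REFEREED], §5.1
  Lemma (statement 31 of the arXiv text) [corpus:paper-arxiv-2210.02948 p0017:L1–L8], verbatim: "Let `X`
  and `Z` be projective hyper-Kähler varieties. Assume that there exists an algebraic cycle `γ` on `Z × X`
  which induces a rational Hodge isometry `γ_* : H²_tr(Z) ⥲ H²_tr(X)(k)`, for some non-zero `k ∈ ℚ`. Then,
  if [the Kuga–Satake statement of §5.1] holds for `X`, it holds for `Z` as well." (proof L10–L30: the
  isogeny of Kuga–Satake varieties and `φ_* ∘ ζ_* ∘ γ_*`.)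
* [Var23] M. Varesco, *Hodge similarities, algebraic classes, and Kuga–Satake varieties*, Math. Z. 305
  (2023) (arXiv:2304.02519) [`Varesco2023`; REFEREED], **Prop. 3.1** [corpus:paper-arxiv-2304.02519
  p0012:L7–L18], verbatim: "Let `ψ : (V,q) → (V',q')` be a Hodge similarity of polarized Hodge structures
  of K3-type. Then, there exists an isogeny of abelian varieties `ψ_KS : KS(V) → KS(V')` making the
  following diagram commute [`V → V'` over `H¹(KS(V),ℚ)^{⊗2} → H¹(KS(V'),ℚ)^{⊗2}`], where the vertical
  arrows are the Kuga–Satake correspondence for `(V,q)` and `(V',q')`."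

## Rendering (tree carriers) and faithfulness

* "hyper-Kähler varieties `X`, `Y` (projective, any dimensions)": `IsProjectiveIrreducibleSymplectic
  (2 * n₁) X`, `IsProjectiveIrreducibleSymplectic (2 * n₂) Y` (file `OGradySixType`), `1 ≤ nᵢ`.
* "`φ : H²_tr(X,ℚ) → H²_tr(Y,ℚ)` a rational Hodge similitude induced by an algebraic cycle on `X × Y`": a
  `ℂ`-linear `φ : H²(X(ℂ); ℂ) → H²(Y(ℂ); ℂ)` with `HodgeTheory.IsAlgebraicCorrespondence (2 * n₂) (2 * n₁)
  Y X φ` (the cycle's action on all of `H²`; `ℂ`-span of cycle classes — layer convention) which maps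
  rational classes to rational classes (`ℚ`-cycle), restricts to a BIJECTION `transcendentalPart X b_X →
  transcendentalPart Y b_Y` of the transcendental parts `NS^{⊥_b} ⊗ ℂ` (file `KummerTypeAssociatedK3Surface`)
  for Fujiki forms `b_X`, `b_Y` (the Beauville–Bogomolov forms up to scalar, file
  `KummerTypeHodgeSimilitudes`), and is ISOMETRIC there from `b_X` to `b_Y` — i.e. a similitude for the
  Beauville–Bogomolov forms with some non-zero multiplier ("multiplies the form by some non-zero
  `k ∈ ℚ`"; the value of `k` is immaterial in print and unrecorded here).  "Hodge" is automatic for a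
  cycle-induced map and is not a separate clause.  These hypotheses are exactly those of
  `Floccari2026_associatedK3Surface_kummerType` / `Floccari2026_k3HilbertTypeSubvariety_kummerType`'s
  conclusions, so the records compose in the kernel (below).
* "Conjecture 3.3 for `Y` implies Conjecture 3.3 for `X`": `IsKSCorrespondenceAlgebraicHK n₂ hY.1 →
  IsKSCorrespondenceAlgebraicHK n₁ hX.1` (Floccari's `H²_tr`-form, Rem. 3.4, on the real carriers; for
  `nᵢ = 1` this is the HYPERKÄHLER-form predicate at a K3 surface, not the surface predicate
  `HodgeTheory.IsKSCorrespondenceAlgebraicBetti` — the two are not identified in the tree, see the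
  definitions file).  Grade: REFEREED (Geom. Topol. 2026 Remark with proof; Compos. Math. 2024 Lemma with
  proof; Math. Z. 2023 Prop. 3.1).  HONEST FRAMING: typed ≠ proved; a transfer statement, asserting the
  Kuga–Satake statement for no variety by itself.

## Content and D-0026 accounting

ONE named fact (+1; a refereed published result cited at the line; `lean search` for
`transfer|similitude.*KSCorrespondence|KSisogeny` in `Hyperkaehler/`, `HodgeTheory/`, `Motives/` finds
the framework-`B` functoriality files `Motives/KugaSatakeFunctoriality` (abstract Hodge structures, no
variety-level transfer of the real-carrier predicate) and nothing on `IsKSCorrespondenceAlgebraicHK`):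
`Floccari2026_kugaSatakeCorrespondence_algebraic_transfer`.  Kernel: `.of_kummerType_target` (any `X`
algebraically transcendental-similar to a projective `Kumⁿ` satisfies the Kuga–Satake statement, by
Voisin's theorem), `.kummerType_of_k3HilbertSubvariety` (the restriction `i^* : H²(K) → H²(W)` of
`Floccari2026_k3HilbertTypeSubvariety_kummerType` is such a `φ`, by `isAlgebraicCorrespondence_map` and
`IsRationalClass.pullback`: the Kuga–Satake statement for the `K3^[m]`-type subvariety `W` gives it for `K`).

## Not here

The isogeny `Ψ` itself and Varesco's diagram (framework-`B` versions live in `Motives/KugaSatakeFunctoriality`,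
`Motives/KugaSatakeOfK3TypeFormFunctorial`); Varesco's Thm. 4.5 / Cor. 4.6 (algebraicity of Hodge
similitudes given the Kuga–Satake statement for both sides and Lefschetz in degree `2` — recorded for
`Kumⁿ` as `Varesco2023_hodgeSimilitude_algebraic_kummerType`); the converse transfer (needs the inverse
of `φ` to be algebraic, e.g. [Flo26] Thm. 5.9's isomorphism of motives); any proof.
-/

noncomputable section

open CategoryTheory _root_.AlgebraicGeometry
open Literature.AlgebraicTopology.SingularHomology

namespace Literature.AlgebraicGeometry.Hyperkaehler

open HodgeTheory

/-- **Floccari 2026, Remark 3.7 (= Floccari 2024 §5.1 Lemma; Kuga–Satake functoriality: Varesco 2023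
Prop. 3.1): the Kuga–Satake statement transfers contravariantly along an algebraic Hodge similitude of
rational transcendental lattices.**  For projective irreducible symplectic `X` (dimension `2n₁`) and `Y`
(dimension `2n₂`), Fujiki forms `b_X`, `b_Y`, and a `ℂ`-linear `φ : H²(X(ℂ); ℂ) → H²(Y(ℂ); ℂ)` induced by
an algebraic cycle on `Y × X` (`IsAlgebraicCorrespondence (2 * n₂) (2 * n₁) Y X φ`), mapping rational
classes to rational classes, bijective from `NS(X)^{⊥_{b_X}} ⊗ ℂ` onto `NS(Y)^{⊥_{b_Y}} ⊗ ℂ` and isometric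
there ("`φ : H²_tr(X,ℚ) → H²_tr(Y,ℚ)` is a rational Hodge similitude […] induced by an algebraic cycle
on `X × Y`"): if the Kuga–Satake correspondence of `Y` is algebraic then so is that of `X` ("Then
[statement 3.3] for `Y` implies [statement 3.3] for `X`").  Rendering and the printed sentences: module
docstring.  A published, refereed result (Remark with proof in Geom. Topol. 2026; Lemma with proof in
Compos. Math. 2024; unproved in the tree). [cite: Floccari2026, Rem. 3.7 with §3.5 (Rem. 3.4 for the H²_tr-form)]
[cite: Floccari2024, §5.1 Lemma (statement 31 of the arXiv text: transfer along γ_* : H²_tr(Z) ⥲ H²_tr(X)(k))]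
[cite: Varesco2023, Prop. 3.1 (the isogeny ψ_KS and the commutative square)] -/
def Floccari2026_kugaSatakeCorrespondence_algebraic_transfer : Prop :=
  ∀ (n₁ n₂ : ℕ), 1 ≤ n₁ → 1 ≤ n₂ →
  ∀ ⦃X Y : Motives.SchemeOver ℂ⦄ (hX : IsProjectiveIrreducibleSymplectic (2 * n₁) X)
    (hY : IsProjectiveIrreducibleSymplectic (2 * n₂) Y)
    (bX : complexBetti X 2 →ₗ[ℂ] complexBetti X 2 →ₗ[ℂ] ℂ)
    (bY : complexBetti Y 2 →ₗ[ℂ] complexBetti Y 2 →ₗ[ℂ] ℂ),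
    IsFujikiForm n₁ X bX → IsFujikiForm n₂ Y bY →
  ∀ (φ : complexBetti X 2 →ₗ[ℂ] complexBetti Y 2),
    IsAlgebraicCorrespondence (2 * n₂) (2 * n₁) Y X φ →
    (∀ x : complexBetti X 2, IsRationalClass x → IsRationalClass (φ x)) →
    Set.BijOn φ (transcendentalPart X bX) (transcendentalPart Y bY) →
    (∀ x ∈ transcendentalPart X bX, ∀ y ∈ transcendentalPart X bX, bY (φ x) (φ y) = bX x y) →
    IsKSCorrespondenceAlgebraicHK n₂ hY.1 → IsKSCorrespondenceAlgebraicHK n₁ hX.1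

namespace Floccari2026_kugaSatakeCorrespondence_algebraic_transfer

/-- **Transfer from a `Kumⁿ`-type target (with Voisin 2022):** a projective irreducible symplectic `X`
whose rational transcendental lattice is carried, by an algebraic Hodge similitude, onto that of a
projective irreducible symplectic variety `Y` of `Kumⁿ`-type (`n ≥ 2`) satisfies the Kuga–Satake
statement — the printed route by which Floccari obtains it for the K3 surfaces `S_K` (there with the
surface-side predicate). [cite: Floccari2026, Rem. 3.7 and proof of Thm. 5.10 (i)]
[cite: Voisin2022FootnotesOGradyMarkman, Thm. 1.5 = Thm. 4.1] -/
theorem of_kummerType_target (h : Floccari2026_kugaSatakeCorrespondence_algebraic_transfer)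
    (hV : Voisin2022_kugaSatakeCorrespondence_algebraic_kummerType)
    {n₁ n : ℕ} (hn₁ : 1 ≤ n₁) (hn : 2 ≤ n) {X Y : Motives.SchemeOver ℂ}
    (hX : IsProjectiveIrreducibleSymplectic (2 * n₁) X) (hY : IsProjectiveIrreducibleSymplectic (2 * n) Y)
    (hKum : IsOfGeneralizedKummerType n Y)
    {bX : complexBetti X 2 →ₗ[ℂ] complexBetti X 2 →ₗ[ℂ] ℂ}
    {bY : complexBetti Y 2 →ₗ[ℂ] complexBetti Y 2 →ₗ[ℂ] ℂ}
    (hbX : IsFujikiForm n₁ X bX) (hbY : IsFujikiForm n Y bY)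
    {φ : complexBetti X 2 →ₗ[ℂ] complexBetti Y 2}
    (hφ : IsAlgebraicCorrespondence (2 * n) (2 * n₁) Y X φ)
    (hφrat : ∀ x : complexBetti X 2, IsRationalClass x → IsRationalClass (φ x))
    (hφbij : Set.BijOn φ (transcendentalPart X bX) (transcendentalPart Y bY))
    (hφiso : ∀ x ∈ transcendentalPart X bX, ∀ y ∈ transcendentalPart X bX, bY (φ x) (φ y) = bX x y) :
    IsKSCorrespondenceAlgebraicHK n₁ hX.1 :=
  h n₁ n hn₁ (by omega) hX hY bX bY hbX hbY φ hφ hφrat hφbij hφiso (hV n hn hY.1 hKum)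

/-- **Transfer along the restriction to the `K3^[m]`-type subvariety (with Floccari 2026 Lemma 5.5):**
for a projective `Kumⁿ`-type `K` which is irreducible symplectic and a Fujiki form `b` on it, the
record `Floccari2026_k3HilbertTypeSubvariety_kummerType` provides `W ⊂ K` of `K3^[m]`-type with
`i^* : H²(K) → H²(W)` injective, isometric and bijective on transcendental parts; `i^*` is induced by an
algebraic cycle (the graph, `isAlgebraicCorrespondence_map`) and preserves rational classes
(`IsRationalClass.pullback`), so — if that `W` is irreducible symplectic (hypothesis `hIS`, classically
automatic for `K3^[m]`-type) — the Kuga–Satake statement for `W` implies the Kuga–Satake statement for `K`.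
Kernel, modulo the two records. [cite: Floccari2026, Rem. 3.7 and Lemma 5.5] -/
theorem kummerType_of_k3HilbertSubvariety (h : Floccari2026_kugaSatakeCorrespondence_algebraic_transfer)
    (hW : Floccari2026_k3HilbertTypeSubvariety_kummerType)
    {n : ℕ} (hn : 2 ≤ n) {K : Motives.SchemeOver ℂ} (hK : IsProjectiveIrreducibleSymplectic (2 * n) K)
    (hKum : IsOfGeneralizedKummerType n K)
    {b : complexBetti K 2 →ₗ[ℂ] complexBetti K 2 →ₗ[ℂ] ℂ} (hb : IsFujikiForm n K b)
    (hIS : ∀ (m : ℕ) (W : Motives.SchemeOver ℂ), Motives.IsSmoothProjective (2 * m) W →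
      IsOfK3HilbertType m W → IsProjectiveIrreducibleSymplectic (2 * m) W) :
    ∃ (m : ℕ) (W : Motives.SchemeOver ℂ) (i : W ⟶ K) (hWis : IsProjectiveIrreducibleSymplectic (2 * m) W),
      (2 * m = n ∨ 2 * m = n + 1) ∧ IsOfK3HilbertType m W ∧ IsClosedImmersion i.left ∧
      (IsKSCorrespondenceAlgebraicHK m hWis.1 → IsKSCorrespondenceAlgebraicHK n hK.1) := by
  obtain ⟨m, W, i, bW, hm, hWsp, hK3, hi, hbW, hinj, hiso, hbij⟩ := hW n hn hK.1 hKum b hb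
  have hWis : IsProjectiveIrreducibleSymplectic (2 * m) W := hIS m W hWsp hK3
  have hm1 : 1 ≤ m := by omega
  refine ⟨m, W, i, hWis, hm, hK3, hi, fun hKS ↦ ?_⟩
  refine h n m (by omega) hm1 hK hWis b bW hb hbW (complexBetti.map i 2).hom
    (isAlgebraicCorrespondence_map hWsp hK.1 i (by omega)) (fun x hx ↦ hx.pullback _) hbij
    (fun x _ y _ ↦ hiso x y) hKS

end Floccari2026_kugaSatakeCorrespondence_algebraic_transfer

end Literature.AlgebraicGeometry.Hyperkaehler

end
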